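import Mathlib.Analysis.SpecialFunctions.Exp
import Mathlib.Analysis.SpecialFunctions.Log.Basic
import Mathlib.Topology.Algebra.Order.LiminfLimsup
import Mathlib.Order.Filter.AtTopBot.Field
import HarnessLib

/-!
# Balanced exponential sums (real-analysis lemmas for the Kempf–Ness argument)

Support file for the proof of Bürgisser–Ikenmeyer 2017, Cor. 2.9 (`det_n` and `per_n` are
polystable, `Polystability.lean`), Kempf–Ness part. Along a one-parameter subgroup
`diag(e^{sθ})` the squared norm of a tensor is an exponential sum `F(s) = ∑ c_j e^{s w_j}` with
`c_j ≥ 0`; criticality makes it *balanced*, `F'(0) = ∑ c_j w_j = 0`. Proved here (Kempf–Ness 1979,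
the convexity in the proof of Thm. 0.2, made quantitative with `eˣ ≥ 1 + x` only):

* `expSum_mono` — a balanced exponential sum is nondecreasing on `[0, ∞)`;
* `nonpos_of_expSum_le`, `eq_zero_of_expSum_le_of_balanced` — if it stays bounded on `[0, ∞)`
  then every active weight vanishes;
* `eventually_pos_expSum` — the blow-up lemma: if `r_m → ∞`, `ε^m → e`, `p^m → e` and some
  `e_c > 0` then eventually `∑ c, e^{2 r_m ε^m_c} p^m_c > 0`.

Everything is proved; [folklore].

## References

* G. Kempf, L. Ness, *The length of vectors in representation spaces*, LNM 732 (1979),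
  proof of Thm. 0.2.
-/

noncomputable section

open Finset Filter
open scoped Topology

namespace Literature.Computability.AlgebraicComplexity

/-! ### Sums of exponentials -/
section ExpSum

variable {ι : Type*} [Fintype ι]

/-- **Monotonicity of a balanced exponential sum**: if `c ≥ 0` and `∑ c i * w i = 0` then
`s ↦ ∑ c i * exp (s * w i)` is nondecreasing on `[0, ∞)` (convexity: `eˣ ≥ 1 + x`). [folklore] -/
theorem expSum_mono {c w : ι → ℝ} (hc : ∀ i, 0 ≤ c i) (hbal : ∑ i, c i * w i = 0) {s t : ℝ}
    (hs : 0 ≤ s) (hst : s ≤ t) :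
    ∑ i, c i * Real.exp (s * w i) ≤ ∑ i, c i * Real.exp (t * w i) := by
  -- termwise: c e^{tw} - c e^{sw} = c e^{sw} (e^{(t-s)w} - 1) ≥ c e^{sw} (t-s) w ≥ c (t - s) w ... summed ≥ 0
  have key : ∀ i, c i * ((t - s) * w i) ≤ c i * Real.exp (t * w i) - c i * Real.exp (s * w i) := by
    intro i
    have h1 : Real.exp (s * w i) * ((t - s) * w i) ≤
        Real.exp (s * w i) * (Real.exp ((t - s) * w i) - 1) := by
      refine mul_le_mul_of_nonneg_left ?_ (Real.exp_pos _).le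
      linarith [Real.add_one_le_exp ((t - s) * w i)]
    have h2 : (t - s) * w i ≤ Real.exp (s * w i) * ((t - s) * w i) := by
      -- `w i` and `e^{s w i} - 1` have the same sign
      have : 0 ≤ (Real.exp (s * w i) - 1) * ((t - s) * w i) := by
        rcases le_total 0 (w i) with hw | hw
        · refine mul_nonneg ?_ (mul_nonneg (by linarith) hw)
          have : 0 ≤ s * w i := mul_nonneg hs hw
          linarith [Real.add_one_le_exp (s * w i)]
        · refine mul_nonneg_of_nonpos_of_nonpos ?_ (mul_nonpos_of_nonneg_of_nonpos (by linarith) hw)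
          have : s * w i ≤ 0 := mul_nonpos_of_nonneg_of_nonpos hs hw
          have := Real.exp_le_one_iff.mpr this
          linarith
      nlinarith
    have h3 : Real.exp (s * w i) * (Real.exp ((t - s) * w i) - 1) =
        Real.exp (t * w i) - Real.exp (s * w i) := by
      rw [mul_sub, ← Real.exp_add, mul_one]
      congr 2
      ring
    calc c i * ((t - s) * w i) ≤ c i * (Real.exp (s * w i) * ((t - s) * w i)) :=
          mul_le_mul_of_nonneg_left h2 (hc i)
      _ ≤ c i * (Real.exp (s * w i) * (Real.exp ((t - s) * w i) - 1)) :=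
          mul_le_mul_of_nonneg_left h1 (hc i)
      _ = c i * Real.exp (t * w i) - c i * Real.exp (s * w i) := by rw [h3, mul_sub]
  have hsum := Finset.sum_le_sum fun i (_ : i ∈ Finset.univ) => key i
  rw [Finset.sum_sub_distrib] at hsum
  have h0 : ∑ i, c i * ((t - s) * w i) = 0 := by
    have : ∑ i, c i * ((t - s) * w i) = (t - s) * ∑ i, c i * w i := by
      rw [Finset.mul_sum]; refine Finset.sum_congr rfl fun i _ => by ring
    rw [this, hbal, mul_zero]
  linarith

/-- If an exponential sum with nonnegative coefficients stays bounded on `[0, ∞)`, every weight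
carrying a positive coefficient is `≤ 0`. [folklore] -/
theorem nonpos_of_expSum_le {c w : ι → ℝ} (hc : ∀ i, 0 ≤ c i) {C : ℝ}
    (hbd : ∀ s, 0 ≤ s → ∑ i, c i * Real.exp (s * w i) ≤ C) {i : ι} (hi : 0 < c i) : w i ≤ 0 := by
  classical
  by_contra hw
  push Not at hw
  -- at `s = (C / c i + 1) / w i` the `i`-th term alone exceeds `C`
  set s : ℝ := (C / c i + 1) / w i with hs
  have hterm : ∀ s, 0 ≤ s → c i * Real.exp (s * w i) ≤ C := by
    intro s hs'
    refine le_trans ?_ (hbd s hs')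
    rw [← Finset.sum_erase_add _ _ (Finset.mem_univ i)]
    have : 0 ≤ ∑ x ∈ Finset.univ.erase i, c x * Real.exp (s * w x) :=
      Finset.sum_nonneg fun x _ => mul_nonneg (hc x) (Real.exp_pos _).le
    linarith
  -- choose `s` large with `s * w i ≥ C / c i + 1`
  obtain ⟨s, hs0, hsw⟩ : ∃ s : ℝ, 0 ≤ s ∧ C / c i + 1 ≤ s * w i := by
    refine ⟨max s 0, le_max_right _ _, ?_⟩
    have : s * w i = C / c i + 1 := by rw [hs]; field_simp
    calc C / c i + 1 = s * w i := this.symm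
      _ ≤ max s 0 * w i := mul_le_mul_of_nonneg_right (le_max_left _ _) hw.le
  have h1 := hterm s hs0
  have h2 : C / c i + 1 ≤ Real.exp (s * w i) := by
    have := Real.add_one_le_exp (s * w i)
    linarith
  have h3 : c i * (C / c i + 1) ≤ c i * Real.exp (s * w i) := mul_le_mul_of_nonneg_left h2 hi.le
  have h4 : c i * (C / c i + 1) = C + c i := by field_simp
  linarith

/-- Bounded balanced exponential sums have all their active weights equal to zero. [folklore] -/
theorem eq_zero_of_expSum_le_of_balanced {c w : ι → ℝ} (hc : ∀ i, 0 ≤ c i)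
    (hbal : ∑ i, c i * w i = 0) {C : ℝ} (hbd : ∀ s, 0 ≤ s → ∑ i, c i * Real.exp (s * w i) ≤ C)
    {i : ι} (hi : 0 < c i) : w i = 0 := by
  have hle : ∀ x, c x * w x ≤ 0 := by
    intro x
    rcases (hc x).lt_or_eq with hx | hx
    · exact mul_nonpos_of_nonneg_of_nonpos (hc x) (nonpos_of_expSum_le hc hbd hx)
    · rw [← hx, zero_mul]
  have hall := (Finset.sum_eq_zero_iff_of_nonpos fun x (_ : x ∈ Finset.univ) => hle x).mp hbal
  have := hall i (Finset.mem_univ i)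
  rcases mul_eq_zero.mp this with h | h
  · exact absurd h hi.ne'
  · exact h

end ExpSum

/-! ### The contradiction in the unbounded case -/
section Blowup

variable {σ : Type*} [Fintype σ]

/-- **Escape to infinity forces a positive derivative.** If `r_m → ∞`, `ε^m → e`,
`p^m_c → e_c` and some `e_c > 0`, then eventually `∑ c, exp (2 r_m ε^m_c) p^m_c > 0`
(the `c` maximising `e` dominates). [folklore] -/
theorem eventually_pos_expSum {r : ℕ → ℝ} (hr : Tendsto r atTop atTop) {ε : ℕ → σ → ℝ}
    {e : σ → ℝ} (hε : ∀ c, Tendsto (fun m => ε m c) atTop (𝓝 (e c))) {p : ℕ → σ → ℝ}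
    (hp : ∀ c, Tendsto (fun m => p m c) atTop (𝓝 (e c))) (hpos : ∃ c, 0 < e c) :
    ∀ᶠ m in atTop, 0 < ∑ c, Real.exp (2 * (r m * ε m c)) * p m c := by
  classical
  obtain ⟨c₀, hc₀⟩ := hpos
  -- `cs` maximises `e`
  obtain ⟨cs, -, hcs⟩ := Finset.exists_max_image Finset.univ e ⟨c₀, Finset.mem_univ _⟩
  set M₀ := e cs with hM₀
  have hM₀pos : 0 < M₀ := lt_of_lt_of_le hc₀ (hcs c₀ (Finset.mem_univ _))
  -- normalised terms `q m c = exp (2 r (ε c - ε cs)) * p c`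
  set q : ℕ → σ → ℝ := fun m c => Real.exp (2 * (r m * (ε m c - ε m cs))) * p m c with hq
  have hfactor : ∀ m, ∑ c, Real.exp (2 * (r m * ε m c)) * p m c =
      Real.exp (2 * (r m * ε m cs)) * ∑ c, q m c := by
    intro m
    rw [Finset.mul_sum]
    refine Finset.sum_congr rfl fun c _ => ?_
    rw [hq]
    simp only
    rw [← mul_assoc (Real.exp _), ← Real.exp_add]
    congr 1
    congr 1
    ring
  -- it suffices that eventually `∑ q > 0`
  suffices h : ∀ᶠ m in atTop, 0 < ∑ c, q m c by
    filter_upwards [h] with m hm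
    rw [hfactor]
    exact mul_pos (Real.exp_pos _) hm
  set A : Finset σ := Finset.univ.filter (fun c => e c = M₀) with hA
  set B : Finset σ := Finset.univ.filter (fun c => e c < M₀) with hB
  have hAB : ∀ m, ∑ c, q m c = ∑ c ∈ A, q m c + ∑ c ∈ B, q m c := by
    intro m
    rw [← Finset.sum_filter_add_sum_filter_not Finset.univ (fun c => e c = M₀)]
    congr 1
    refine Finset.sum_congr ?_ fun _ _ => rfl
    ext c
    simp only [Finset.mem_filter, Finset.mem_univ, true_and, hB]
    exact ⟨fun h => lt_of_le_of_ne (hcs c (Finset.mem_univ _)) h, fun h => h.ne⟩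
  -- on `B` the terms tend to `0`
  have hBlim : Tendsto (fun m => ∑ c ∈ B, q m c) atTop (𝓝 0) := by
    rw [show (0 : ℝ) = ∑ c ∈ B, (0 : ℝ) from Finset.sum_const_zero.symm]
    refine tendsto_finsetSum B fun c hc => ?_
    have hc' : e c < M₀ := by simpa [hB] using hc
    have h1 : Tendsto (fun m => ε m c - ε m cs) atTop (𝓝 (e c - M₀)) := (hε c).sub (hε cs)
    have h2 : Tendsto (fun m => r m * (ε m c - ε m cs)) atTop atBot :=
      hr.atTop_mul_neg (by linarith) h1
    have h3 : Tendsto (fun m => 2 * (r m * (ε m c - ε m cs))) atTop atBot :=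
      Tendsto.const_mul_atBot (by norm_num) h2
    have h4 : Tendsto (fun m => Real.exp (2 * (r m * (ε m c - ε m cs)))) atTop (𝓝 0) :=
      Real.tendsto_exp_atBot.comp h3
    have := h4.mul (hp c)
    simpa [hq] using this
  -- on `A` the terms are eventually nonnegative and the `cs` term tends to `M₀`
  have hApos : ∀ᶠ m in atTop, ∀ c, c ∈ A → 0 ≤ q m c := by
    rw [Filter.eventually_all]
    intro c
    by_cases hc : c ∈ A
    · have hc' : e c = M₀ := by simpa [hA] using hc
      have : ∀ᶠ m in atTop, 0 < p m c := (hp c).eventually_const_lt (by rw [hc']; exact hM₀pos)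
      filter_upwards [this] with m hm
      intro _
      exact mul_nonneg (Real.exp_pos _).le hm.le
    · exact Filter.Eventually.of_forall fun m h => absurd h hc
  have hcsA : cs ∈ A := by simp [hA, hM₀]
  have hcs_term : ∀ m, q m cs = p m cs := by
    intro m; rw [hq]; simp
  have hcs_lim : ∀ᶠ m in atTop, 3 * M₀ / 4 < p m cs :=
    (hp cs).eventually_const_lt (by rw [← hM₀]; linarith)
  have hB_ev : ∀ᶠ m in atTop, -(M₀ / 4) < ∑ c ∈ B, q m c :=
    hBlim.eventually_const_lt (by linarith)
  filter_upwards [hApos, hcs_lim, hB_ev] with m hmA hmcs hmB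
  rw [hAB]
  have hAge : p m cs ≤ ∑ c ∈ A, q m c := by
    rw [← hcs_term m]
    exact Finset.single_le_sum (fun c hc => hmA c hc) hcsA
  linarith

end Blowup

end Literature.Computability.AlgebraicComplexity
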